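import Literature.MathematicalPhysics.PowerSystems.CompleteKuramotoStabilityCriterion
import Literature.Analysis.Matrix.SylvesterInertiaCertificate
import HarnessLib

/-!
# The INDEX THEOREM for the finite-`N` all-to-all Kuramoto model (Bronski–DeVille–Park 2012,
# Theorem 2.2 with Proposition 2.1): at every configuration `θ` with `κᵢ = Σⱼ cos(θⱼ − θᵢ) ≠ 0` and
# `τ = Σᵢ 1/κᵢ ≠ 2` the Jacobian has exactly `#{i : κᵢ < 0} + [τ > 2]` unstable directions, a simple
# zero (the rotation) and no other non-negative eigenvalue — for ARBITRARY natural frequencies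

Topic `Literature/MathematicalPhysics/PowerSystems`, namespace
`Literature.MathematicalPhysics.PowerSystems.NonuniformKuramoto`. Sequel of
`CompleteKuramotoStabilityCriterion.lean` (the STABLE case `n₊ = 0` of the same theorem, typed there
as the closed-form criterion `κᵢ > 0 ∧ τ ≤ 2`); this file types the COUNT for all types. Records and
tools used UNCHANGED: `NonuniformKuramoto n`, `classic N K ω`, `toDroopNetwork.lap θ` / `auxJac θ`
(`jacobian_eq_neg_lap`: for `Dᵢ = 1` the Jacobian of the field is `−L(θ)`), Mathlib's spectrum
`Matrix.IsHermitian.eigenvalues` (with multiplicity), the tree's Courant–Fischer count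
`Literature.Analysis.Matrix.EigenvalueCount.card_le_card_eigenvalues_gt` and eigen-expansion
`KyFan.dotProduct_mulVec_eq_sum_eigen`. Everything below is PROVED: no definition, no named fact,
no new axiom, no `sorry`.

SOURCE (read on the page; held LaTeX `lit read arxiv:1111.5302`). J. C. Bronski, L. DeVille,
M. J. Park, Chaos **22** (2012) 033133 [BronskiDeVillePark2012], §2.2 (p0005 L77–p0006 L100):
**Definition 2.2** (`n₊(A), n₋(A), n₀(A)` = numbers of eigenvalues with positive, negative, zero real
part, «the indices of `A`»); eq. (J) `Jᵢⱼ = cos(θᵢ − θⱼ)` (`i ≠ j`), `Jᵢᵢ = −Σ_{k≠i} cos(θₖ − θᵢ)`;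
eq. (rank2) `J = −D + v⊗v + w⊗w`, `v = (sin θᵢ)`, `w = (cos θᵢ)`, `Dᵢᵢ = Σₖ cos(θₖ − θᵢ)` («a positive
semi-definite rank two perturbation of a diagonal matrix … the indices of `J` and `D` can differ by at
most two»); **Proposition 2.1** «rotate the configuration so that the order parameter is on the
positive real axis. Then `n₊(−D) = #{θᵢ | cos(θᵢ) < 0}`»; «Since the perturbation is rank two, and
one of the eigenvalues of the Jacobian is zero, if `D` is negative-definite then there is only one
eigenvalue whose sign is to be determined»; **Theorem 2.2** «Suppose `D` is invertible. Define
`τ = Σᵢ 1/Σⱼcos(θⱼ − θᵢ) = ⟨v,D⁻¹v⟩ + ⟨w,D⁻¹w⟩ = ⟨𝟙,D⁻¹𝟙⟩`. Then `n₊(J) = n₊(−D) + {0, τ < 2; 1, τ > 2}`»,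
with its proof: the homotopy `J_η = −D + η(v⊗v + w⊗w)`, the kernel equation (x)
`x = η(⟨v,x⟩D⁻¹v + ⟨w,x⟩D⁻¹w)`, the `2×2` matrix `M_η` (defofmeta), «at `η = 1` … `M₁` is singular so
that one of the eigenvalues is zero … the other is equal to the trace, `Tr(M₁) = ⟨𝟙,D⁻¹𝟙⟩ − 2 = τ − 2`.
Thus if this quantity is positive a single eigenvalue has crossed into the right half-plane … If this
quantity is negative then no eigenvalues have crossed». R. A. Horn, C. R. Johnson, *Matrix Analysis*
2nd ed. [HornJohnson2013], Thm 4.2.10 / Cor. 4.2.12 (p0306; the subspace counts, as typed in the tree).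

WHAT IS PROVED (`κᵢ := Σⱼ cos(θᵢ − θⱼ)`, `σᵢ := Σⱼ sin(θᵢ − θⱼ)`, `a + ib := Σⱼ e^{iθⱼ}`,
`Q(x) := Σᵢ xᵢ Σⱼ cos(θᵢ − θⱼ)(xᵢ − xⱼ) = −xᵀJx`, `τ := Σᵢ 1/κᵢ`; all spelled out):
* §1 (Horn–Johnson 4.2.10 in kernel form, any finite index type)
  `card_eigenvalues_pos_le_of_nonpos_on_ker` (`xᵀWx ≤ 0` on `ker L`, `dim(target L) ≤ k` ⇒ at most
  `k` positive eigenvalues), `card_eigenvalues_nonneg_le_of_neg_on_ker` (strict version: at most `k`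
  eigenvalues `≥ 0`).
* §2 `allToAll_linForm_eq_split` — the two Schur complements of `[[−D, U],[Uᵀ, −1]]` compared:
  `Q(x) = Σκᵢ(xᵢ − (Ud)ᵢ/κᵢ)² − dᵀM₁d − ‖d − Uᵀx‖²` for every `d ∈ ℝ²` (`M₁ = UᵀD⁻¹U − 1`);
  `rankTwo_form_eq` — `dᵀM₁d = (τ − 2)(a d₂ − b d₁)²/(a² + b²)` (`M₁(a,b)ᵀ = 0`, `Tr M₁ = τ − 2`);
  `sum_rowSum_cos_mul_eq`, `allToAll_linForm_add_const` (`Q(x + t𝟙) = Q(x)`).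
* §3 for ANY real symmetric `W` with `xᵀWx = −cQ(x)`, `c > 0`:
  `card_rowSum_neg_le_card_eigenvalues_pos` (`n₊ ≥ #{κᵢ<0}`: test vectors `eᵢ`),
  `card_rowSum_neg_succ_le_card_eigenvalues_pos` (`τ > 2`: `n₊ ≥ #{κᵢ<0} + 1`, extra test vector
  `D⁻¹U(−b,a) = σ/κ`), `sum_sum_cos_pos_of_rowSum_ne_zero`, `eq_zero_of_fixed_of_orderParam`,
  `allToAll_linForm_ge_of_constraint`, `card_eigenvalues_pos_le_card_rowSum_neg` (`τ ≤ 2`: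
  `n₊ ≤ #{κᵢ<0}`), `card_eigenvalues_pos_le_card_rowSum_neg_succ` (`n₊ ≤ #{κᵢ<0} + 1` always),
  `card_eigenvalues_nonneg_le_card_rowSum_neg_succ` / `…_add_two` (counts of eigenvalues `≥ 0`),
  `exists_eigenvalues_eq_zero` (`J𝟙 = 0` by polarisation), ★★★ **`inertia_of_allToAll_linForm`**
  (`n₊ = #{κᵢ<0} + [τ>2]`, `n₀ = 1`, `n₋ = n − 1 − n₊`), ★★ `card_eigenvalues_pos_eq_zero_iff`
  (type `0` ⇔ `κᵢ > 0 ∀i ∧ τ < 2`).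
* §4 MODEL: `complete_isHermitian_neg_lap`, `complete_neg_lap_form` (`zᵀ(−L(θ))z = −kQ(z)`),
  ★★★ **`complete_inertia_neg_lap`** (uniform complete coupling `Pᵢⱼ = k > 0`, any `ω`, any `Dᵢ`:
  the inertia of `−L(θ)`), ★★ `complete_typeZero_iff`; `classic_isHermitian_auxJac`,
  ★★★ **`classic_inertia_jacobian`** (classic model, `γ = K/N`: the inertia of THE JACOBIAN
  `∂f/∂θ = auxJac θ`), ★★ `classic_typeZero_iff`.

PROOF ROUTE (documented deviation). The print counts crossings along the homotopy `J_η`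
(Birman–Schwinger); the tree has no continuity-of-spectrum machinery, so the count is typed by
Courant–Fischer on explicit subspaces built from the SAME objects: the comparison of the two Schur
complements of the bordered matrix `[[−D, U],[Uᵀ, −1₂]]` (`J = −D + UUᵀ` versus `M₁ = UᵀD⁻¹U − 1₂`,
Haynsworth) is the identity `allToAll_linForm_eq_split`; lower bounds from the test vectors `eᵢ`
(`κᵢ < 0`) and `D⁻¹U(−b, a)`; upper bounds from the constraint subspaces `{κᵢxᵢ = (UUᵀx)ᵢ, κᵢ<0}`
(`∩ {⟨(−b,a),Uᵀx⟩ = 0}`, `∩ {⟨κ,x⟩ = 0}`) on which `Q ≥ −dᵀM₁d`; `M₁`'s form is `(τ−2)β²/(a²+b²)`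
exactly as the print's trace computation. In-seat numerical cross-check (own Jacobi eigen-solver, plain
python): 7 200 random configurations, `n = 2…7`, all ten classes `(#{κ<0}, [τ>2])` met, `0` mismatches
in `(n₊, n₀, n₋)`.

THREE COLUMNS. CERTIFIED: kernel theorems; for exact data the type of a locked state is read off
`N + 1` signs. MODELLED: first-order Kuramoto / classic Kuramoto on the uniform complete lossless
network (never a grid). NOT CLAIMED: the degenerate cases `κᵢ = 0` or `τ = 2` (excluded in print too),
non-uniform weights, second-order (swing) inertia counts (the swing Jacobian is not symmetric; see
`NegativeHessianDirectionInstability.lean` for the unstable clause), Lemma 2.3 / Thm 2.5 / §§3–4.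
-/

noncomputable section

open Real Set Filter Topology Metric Finset Matrix
open scoped Matrix

namespace Literature.MathematicalPhysics.PowerSystems

namespace NonuniformKuramoto

/-! ### §1. Counting eigenvalues against the form on the kernel of a linear map
(Horn–Johnson Thm 4.2.10 / Cor. 4.2.12 in complement form) -/

section Counting

variable {ι : Type*} [Fintype ι] [DecidableEq ι]

/-- **Courant–Fischer count, kernel form (non-strict).** If the real symmetric `W` satisfies
`xᵀWx ≤ 0` on the kernel of a linear map `L` into a space of dimension `≤ k`, then `W` has at most
`k` positive eigenvalues (with multiplicity): a positive-eigenvector combination in `ker L` would have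
positive form. [cite: HornJohnson2013, Theorem 4.2.10 (b) and Corollary 4.2.12 (counting form), p0306] -/
theorem card_eigenvalues_pos_le_of_nonpos_on_ker {W : Matrix ι ι ℝ} (hW : W.IsHermitian)
    {M : Type*} [AddCommGroup M] [Module ℝ M] [FiniteDimensional ℝ M]
    (L : (ι → ℝ) →ₗ[ℝ] M) {k : ℕ} (hk : Module.finrank ℝ M ≤ k)
    (hker : ∀ x : ι → ℝ, L x = 0 → x ⬝ᵥ W *ᵥ x ≤ 0) :
    (univ.filter fun i => 0 < hW.eigenvalues i).card ≤ k := by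
  classical
  by_contra hlt
  rw [not_le] at hlt
  let E : (ι → ℝ) →ₗ[ℝ] (ι → ℝ) :=
    { toFun := fun c => ∑ i, c i • (hW.eigenvectorBasis i).ofLp
      map_add' := fun c c' => by
        simp only [Pi.add_apply, add_smul, Finset.sum_add_distrib]
      map_smul' := fun r c => by
        simp only [Pi.smul_apply, smul_eq_mul, RingHom.id_apply, Finset.smul_sum, smul_smul] }
  let R : (ι → ℝ) →ₗ[ℝ] ({i // ¬ 0 < hW.eigenvalues i} → ℝ) :=
    { toFun := fun c p => c p.1
      map_add' := fun c c' => rfl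
      map_smul' := fun r c => rfl }
  let Φ : (ι → ℝ) →ₗ[ℝ] M × ({i // ¬ 0 < hW.eigenvalues i} → ℝ) := (L ∘ₗ E).prod R
  have hH : Fintype.card {i // 0 < hW.eigenvalues i}
      = (univ.filter fun i => 0 < hW.eigenvalues i).card := Fintype.card_subtype _
  have hdim : Module.finrank ℝ (M × ({i // ¬ 0 < hW.eigenvalues i} → ℝ))
      < Module.finrank ℝ (ι → ℝ) := by
    rw [Module.finrank_prod, Module.finrank_fintype_fun_eq_card, Module.finrank_fintype_fun_eq_card,
      Fintype.card_subtype_compl, hH]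
    have h1 : (univ.filter fun i => 0 < hW.eigenvalues i).card ≤ Fintype.card ι := by
      rw [← hH]; exact Fintype.card_subtype_le _
    omega
  obtain ⟨c, hcK, hc0⟩ :=
    (Submodule.ne_bot_iff _).mp (LinearMap.ker_ne_bot_of_finrank_lt (f := Φ) hdim)
  have hΦ := LinearMap.mem_ker.mp hcK
  have h1 : L (E c) = 0 := by
    have := congrArg Prod.fst hΦ
    simpa [Φ] using this
  have h2 : ∀ i, ¬ 0 < hW.eigenvalues i → c i = 0 := by
    intro i hi
    have := congrFun (congrArg Prod.snd hΦ) ⟨i, hi⟩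
    simpa [Φ, R] using this
  set x : ι → ℝ := E c with hx
  have hcoord : ∀ j, (hW.eigenvectorBasis j).ofLp ⬝ᵥ x = c j := by
    intro j
    simp only [hx, E, LinearMap.coe_mk, AddHom.coe_mk, dotProduct_sum, dotProduct_smul, smul_eq_mul,
      Literature.Analysis.Matrix.KyFan.eigenvectorBasis_dotProduct hW, mul_ite, mul_one,
      mul_zero, Finset.sum_ite_eq, Finset.mem_univ, if_true]
  have hform := hker x h1
  rw [Literature.Analysis.Matrix.KyFan.dotProduct_mulVec_eq_sum_eigen hW x] at hform
  simp only [hcoord] at hform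
  obtain ⟨j, hj⟩ := Function.ne_iff.mp hc0
  have hj' : c j ≠ 0 := hj
  have hjH : 0 < hW.eigenvalues j := by
    by_contra h
    exact hj' (h2 j h)
  have hpos : 0 < ∑ i, hW.eigenvalues i * c i ^ 2 := by
    refine Finset.sum_pos' (fun i _ => ?_) ⟨j, Finset.mem_univ _, mul_pos hjH (by positivity)⟩
    by_cases h : 0 < hW.eigenvalues i
    · exact mul_nonneg h.le (sq_nonneg _)
    · rw [h2 i h]; simp
  linarith

/-- **Courant–Fischer count, kernel form (strict).** If `xᵀWx < 0` for every non-zero `x` in the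
kernel of a linear map `L` into a space of dimension `≤ k`, then `W` has at most `k` non-negative
eigenvalues (with multiplicity). [cite: HornJohnson2013, Theorem 4.2.10 (b) and Corollary 4.2.12 (counting form), p0306] -/
theorem card_eigenvalues_nonneg_le_of_neg_on_ker {W : Matrix ι ι ℝ} (hW : W.IsHermitian)
    {M : Type*} [AddCommGroup M] [Module ℝ M] [FiniteDimensional ℝ M]
    (L : (ι → ℝ) →ₗ[ℝ] M) {k : ℕ} (hk : Module.finrank ℝ M ≤ k)
    (hker : ∀ x : ι → ℝ, x ≠ 0 → L x = 0 → x ⬝ᵥ W *ᵥ x < 0) :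
    (univ.filter fun i => 0 ≤ hW.eigenvalues i).card ≤ k := by
  classical
  by_contra hlt
  rw [not_le] at hlt
  let E : (ι → ℝ) →ₗ[ℝ] (ι → ℝ) :=
    { toFun := fun c => ∑ i, c i • (hW.eigenvectorBasis i).ofLp
      map_add' := fun c c' => by
        simp only [Pi.add_apply, add_smul, Finset.sum_add_distrib]
      map_smul' := fun r c => by
        simp only [Pi.smul_apply, smul_eq_mul, RingHom.id_apply, Finset.smul_sum, smul_smul] }
  let R : (ι → ℝ) →ₗ[ℝ] ({i // ¬ 0 ≤ hW.eigenvalues i} → ℝ) :=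
    { toFun := fun c p => c p.1
      map_add' := fun c c' => rfl
      map_smul' := fun r c => rfl }
  let Φ : (ι → ℝ) →ₗ[ℝ] M × ({i // ¬ 0 ≤ hW.eigenvalues i} → ℝ) := (L ∘ₗ E).prod R
  have hH : Fintype.card {i // 0 ≤ hW.eigenvalues i}
      = (univ.filter fun i => 0 ≤ hW.eigenvalues i).card := Fintype.card_subtype _
  have hdim : Module.finrank ℝ (M × ({i // ¬ 0 ≤ hW.eigenvalues i} → ℝ))
      < Module.finrank ℝ (ι → ℝ) := by
    rw [Module.finrank_prod, Module.finrank_fintype_fun_eq_card, Module.finrank_fintype_fun_eq_card,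
      Fintype.card_subtype_compl, hH]
    have h1 : (univ.filter fun i => 0 ≤ hW.eigenvalues i).card ≤ Fintype.card ι := by
      rw [← hH]; exact Fintype.card_subtype_le _
    omega
  obtain ⟨c, hcK, hc0⟩ :=
    (Submodule.ne_bot_iff _).mp (LinearMap.ker_ne_bot_of_finrank_lt (f := Φ) hdim)
  have hΦ := LinearMap.mem_ker.mp hcK
  have h1 : L (E c) = 0 := by
    have := congrArg Prod.fst hΦ
    simpa [Φ] using this
  have h2 : ∀ i, ¬ 0 ≤ hW.eigenvalues i → c i = 0 := by
    intro i hi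
    have := congrFun (congrArg Prod.snd hΦ) ⟨i, hi⟩
    simpa [Φ, R] using this
  set x : ι → ℝ := E c with hx
  have hcoord : ∀ j, (hW.eigenvectorBasis j).ofLp ⬝ᵥ x = c j := by
    intro j
    simp only [hx, E, LinearMap.coe_mk, AddHom.coe_mk, dotProduct_sum, dotProduct_smul, smul_eq_mul,
      Literature.Analysis.Matrix.KyFan.eigenvectorBasis_dotProduct hW, mul_ite, mul_one,
      mul_zero, Finset.sum_ite_eq, Finset.mem_univ, if_true]
  obtain ⟨j, hj⟩ := Function.ne_iff.mp hc0
  have hj' : c j ≠ 0 := hj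
  have hx0 : x ≠ 0 := by
    intro h0
    have := hcoord j
    rw [h0, dotProduct_zero] at this
    exact hj' this.symm
  have hform := hker x hx0 h1
  rw [Literature.Analysis.Matrix.KyFan.dotProduct_mulVec_eq_sum_eigen hW x] at hform
  simp only [hcoord] at hform
  have hnn : 0 ≤ ∑ i, hW.eigenvalues i * c i ^ 2 := by
    refine Finset.sum_nonneg fun i _ => ?_
    by_cases h : 0 ≤ hW.eigenvalues i
    · exact mul_nonneg h (sq_nonneg _)
    · rw [h2 i h]; simp
  linarith

end Counting

/-! ### §2. The two identities behind the rank-two count -/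

variable {n : ℕ}

/-- **Completing the square along `D⁻¹U d`** (the two Schur complements of
`[[−D, U],[Uᵀ, −1]]` compared): for every `x` and every `d = (d₁, d₂)`,
`Q(x) = Σᵢ κᵢ (xᵢ − (Ud)ᵢ/κᵢ)² − dᵀM₁d − ‖d − Uᵀx‖²` with `(Ud)ᵢ = d₁cos θᵢ + d₂ sin θᵢ`,
`dᵀM₁d = Σᵢ (Ud)ᵢ²/κᵢ − ‖d‖²` (`M₁ = UᵀD⁻¹U − 1`, the matrix `M_η` of the printed proof at `η = 1`)
and `Uᵀx = (Σ cos θᵢ xᵢ, Σ sin θᵢ xᵢ)`. [cite: BronskiDeVillePark2012, §2.2 Theorem 2.2, proof, eqs. (x), (defofmeta) (arXiv:1111.5302 p0006 L44–L75)] -/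
theorem allToAll_linForm_eq_split (θ x : Fin n → ℝ) (d₁ d₂ : ℝ)
    (hκ : ∀ i, ∑ j, Real.cos (θ i - θ j) ≠ 0) :
    ∑ i, x i * ∑ j, Real.cos (θ i - θ j) * (x i - x j)
      = ∑ i, (∑ j, Real.cos (θ i - θ j))
            * (x i - (d₁ * Real.cos (θ i) + d₂ * Real.sin (θ i)) / ∑ j, Real.cos (θ i - θ j)) ^ 2
        - (∑ i, (d₁ * Real.cos (θ i) + d₂ * Real.sin (θ i)) ^ 2 / ∑ j, Real.cos (θ i - θ j)
            - (d₁ ^ 2 + d₂ ^ 2))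
        - ((d₁ - ∑ i, Real.cos (θ i) * x i) ^ 2 + (d₂ - ∑ i, Real.sin (θ i) * x i) ^ 2) := by
  rw [allToAll_linForm_eq]
  have h1 : ∀ i, (∑ j, Real.cos (θ i - θ j))
      * (x i - (d₁ * Real.cos (θ i) + d₂ * Real.sin (θ i)) / ∑ j, Real.cos (θ i - θ j)) ^ 2
      = (∑ j, Real.cos (θ i - θ j)) * x i ^ 2
        - 2 * (x i * (d₁ * Real.cos (θ i) + d₂ * Real.sin (θ i)))
        + (d₁ * Real.cos (θ i) + d₂ * Real.sin (θ i)) ^ 2 / ∑ j, Real.cos (θ i - θ j) := by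
    intro i
    have hk := hκ i
    field_simp
    ring
  have h2 : ∑ i, x i * (d₁ * Real.cos (θ i) + d₂ * Real.sin (θ i))
      = d₁ * ∑ i, Real.cos (θ i) * x i + d₂ * ∑ i, Real.sin (θ i) * x i := by
    rw [Finset.mul_sum, Finset.mul_sum, ← Finset.sum_add_distrib]
    exact Finset.sum_congr rfl fun i _ => by ring
  rw [Finset.sum_congr rfl fun i _ => h1 i, Finset.sum_add_distrib, Finset.sum_sub_distrib,
    ← Finset.mul_sum, h2]
  ring

/-- **The `2 × 2` matrix `M₁ = UᵀD⁻¹U − 1` has the kernel vector `(a, b)` (the order parameter) and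
the eigenvalue `tr M₁ = τ − 2` on `(−b, a)`**: its form is `dᵀM₁d = (τ − 2)(a d₂ − b d₁)²/(a² + b²)`
(«since one eigenvalue is zero the other is equal to the trace, which is … `τ − 2`»).
[cite: BronskiDeVillePark2012, §2.2 Theorem 2.2, proof, last display «`Tr(M₁) = … = τ − 2`» (arXiv:1111.5302 p0006 L80–L100)] -/
theorem rankTwo_form_eq (θ : Fin n → ℝ) (d₁ d₂ : ℝ)
    (hκ : ∀ i, ∑ j, Real.cos (θ i - θ j) ≠ 0) (hR : ∑ i, ∑ j, Real.cos (θ i - θ j) ≠ 0) :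
    ∑ i, (d₁ * Real.cos (θ i) + d₂ * Real.sin (θ i)) ^ 2 / ∑ j, Real.cos (θ i - θ j)
        - (d₁ ^ 2 + d₂ ^ 2)
      = (∑ i, 1 / ∑ j, Real.cos (θ i - θ j) - 2)
        * ((∑ j, Real.cos (θ j)) * d₂ - (∑ j, Real.sin (θ j)) * d₁) ^ 2
          / ∑ i, ∑ j, Real.cos (θ i - θ j) := by
  have hR2 : ∑ i, ∑ j, Real.cos (θ i - θ j) = (∑ j, Real.cos (θ j)) ^ 2 + (∑ j, Real.sin (θ j)) ^ 2 :=
    sum_sum_cos_sub_eq θ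
  have hg : ∀ i, (∑ i, ∑ j, Real.cos (θ i - θ j)) * (d₁ * Real.cos (θ i) + d₂ * Real.sin (θ i))
      = ((∑ j, Real.cos (θ j)) * d₁ + (∑ j, Real.sin (θ j)) * d₂) * ∑ j, Real.cos (θ i - θ j)
        + ((∑ j, Real.cos (θ j)) * d₂ - (∑ j, Real.sin (θ j)) * d₁) * ∑ j, Real.sin (θ i - θ j) := by
    intro i
    rw [rowSum_cos_eq, rowSum_sin_eq, hR2]
    ring
  have hterm : ∀ i, (∑ i, ∑ j, Real.cos (θ i - θ j)) ^ 2
      * ((d₁ * Real.cos (θ i) + d₂ * Real.sin (θ i)) ^ 2 / ∑ j, Real.cos (θ i - θ j))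
      = ((∑ j, Real.cos (θ j)) * d₁ + (∑ j, Real.sin (θ j)) * d₂) ^ 2 * ∑ j, Real.cos (θ i - θ j)
        + 2 * (((∑ j, Real.cos (θ j)) * d₁ + (∑ j, Real.sin (θ j)) * d₂)
            * ((∑ j, Real.cos (θ j)) * d₂ - (∑ j, Real.sin (θ j)) * d₁)) * ∑ j, Real.sin (θ i - θ j)
        + ((∑ j, Real.cos (θ j)) * d₂ - (∑ j, Real.sin (θ j)) * d₁) ^ 2
            * ((∑ j, Real.sin (θ i - θ j)) ^ 2 / ∑ j, Real.cos (θ i - θ j)) := by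
    intro i
    have hk := hκ i
    have e : (∑ i, ∑ j, Real.cos (θ i - θ j)) ^ 2
        * ((d₁ * Real.cos (θ i) + d₂ * Real.sin (θ i)) ^ 2 / ∑ j, Real.cos (θ i - θ j))
        = ((∑ i, ∑ j, Real.cos (θ i - θ j)) * (d₁ * Real.cos (θ i) + d₂ * Real.sin (θ i))) ^ 2
          / ∑ j, Real.cos (θ i - θ j) := by
      rw [mul_pow, mul_div_assoc]
    rw [e, hg i]
    field_simp
    ring
  have hT := sum_rowSum_sin_sq_div_eq θ hκ
  have hσ0 := sum_rowSum_sin_eq_zero θ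
  have hd : (∑ i, ∑ j, Real.cos (θ i - θ j)) * (d₁ ^ 2 + d₂ ^ 2)
      = ((∑ j, Real.cos (θ j)) * d₁ + (∑ j, Real.sin (θ j)) * d₂) ^ 2
        + ((∑ j, Real.cos (θ j)) * d₂ - (∑ j, Real.sin (θ j)) * d₁) ^ 2 := by
    rw [hR2]; ring
  refine mul_left_cancel₀ (pow_ne_zero 2 hR) ?_
  rw [mul_sub, Finset.mul_sum, Finset.sum_congr rfl fun i _ => hterm i, Finset.sum_add_distrib,
    Finset.sum_add_distrib, ← Finset.mul_sum, ← Finset.mul_sum, ← Finset.mul_sum, hσ0, hT]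
  have e2 : (∑ i, ∑ j, Real.cos (θ i - θ j)) ^ 2
      * ((∑ i, 1 / ∑ j, Real.cos (θ i - θ j) - 2)
        * ((∑ j, Real.cos (θ j)) * d₂ - (∑ j, Real.sin (θ j)) * d₁) ^ 2
          / ∑ i, ∑ j, Real.cos (θ i - θ j))
      = (∑ i, ∑ j, Real.cos (θ i - θ j)) * (∑ i, 1 / ∑ j, Real.cos (θ i - θ j) - 2)
        * ((∑ j, Real.cos (θ j)) * d₂ - (∑ j, Real.sin (θ j)) * d₁) ^ 2 := by
    field_simp
  rw [e2]
  linear_combination (-(∑ i, ∑ j, Real.cos (θ i - θ j))) * hd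

/-- `⟨κ, x⟩ = a⟨w, x⟩ + b⟨v, x⟩`: `Σᵢ κᵢ xᵢ = (Σ cos θⱼ)(Σ cos θᵢ xᵢ) + (Σ sin θⱼ)(Σ sin θᵢ xᵢ)`.
[cite: BronskiDeVillePark2012, §2.2 Prop. 2.1 (arXiv:1111.5302 p0005–p0006)] -/
theorem sum_rowSum_cos_mul_eq (θ x : Fin n → ℝ) :
    ∑ i, (∑ j, Real.cos (θ i - θ j)) * x i
      = (∑ j, Real.cos (θ j)) * ∑ i, Real.cos (θ i) * x i
        + (∑ j, Real.sin (θ j)) * ∑ i, Real.sin (θ i) * x i := by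
  simp only [rowSum_cos_eq θ]
  rw [Finset.mul_sum, Finset.mul_sum, ← Finset.sum_add_distrib]
  exact Finset.sum_congr rfl fun i _ => by ring

/-- `Q` is invariant under the rotation `x ↦ x + t𝟙` (`J𝟙 = 0`). [cite: BronskiDeVillePark2012, §2.1 («continuous symmetry», co-rotating frame) and §2.2 («one of the eigenvalues of the Jacobian is zero») (arXiv:1111.5302 p0004 L16, p0006 L18–L20)] -/
theorem allToAll_linForm_add_const (θ x : Fin n → ℝ) (t : ℝ) :
    ∑ i, (x i + t) * ∑ j, Real.cos (θ i - θ j) * ((x i + t) - (x j + t))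
      = ∑ i, x i * ∑ j, Real.cos (θ i - θ j) * (x i - x j) := by
  have h : ∑ i, (x i + t) * ∑ j, Real.cos (θ i - θ j) * ((x i + t) - (x j + t))
      = ∑ i, (∑ j, Real.cos (θ i - θ j)) * (x i + t) ^ 2
        - ((∑ i, Real.cos (θ i) * (x i + t)) ^ 2 + (∑ i, Real.sin (θ i) * (x i + t)) ^ 2) :=
    allToAll_linForm_eq θ (fun i => x i + t)
  have h0 := allToAll_linForm_eq θ x
  rw [h, h0]
  have e1 : ∑ i, (∑ j, Real.cos (θ i - θ j)) * (x i + t) ^ 2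
      = ∑ i, (∑ j, Real.cos (θ i - θ j)) * x i ^ 2
        + 2 * t * ∑ i, (∑ j, Real.cos (θ i - θ j)) * x i + t ^ 2 * ∑ i, ∑ j, Real.cos (θ i - θ j) := by
    rw [Finset.mul_sum, Finset.mul_sum, ← Finset.sum_add_distrib, ← Finset.sum_add_distrib]
    exact Finset.sum_congr rfl fun i _ => by ring
  have e2 : ∑ i, Real.cos (θ i) * (x i + t) = ∑ i, Real.cos (θ i) * x i + t * ∑ j, Real.cos (θ j) := by
    rw [Finset.mul_sum, ← Finset.sum_add_distrib]
    exact Finset.sum_congr rfl fun i _ => by ring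
  have e3 : ∑ i, Real.sin (θ i) * (x i + t) = ∑ i, Real.sin (θ i) * x i + t * ∑ j, Real.sin (θ j) := by
    rw [Finset.mul_sum, ← Finset.sum_add_distrib]
    exact Finset.sum_congr rfl fun i _ => by ring
  rw [e1, e2, e3, sum_rowSum_cos_mul_eq θ x, sum_sum_cos_sub_eq]
  ring

/-! ### §3. THE INDEX THEOREM for a symmetric matrix carrying the form `−c·Q` (`c > 0`) -/

section Index

variable {θ : Fin n → ℝ} {W : Matrix (Fin n) (Fin n) ℝ} {c : ℝ}

/-- **`n₊(J) ≥ n₊(−D)`**: the coordinate vectors `eᵢ` with `κᵢ < 0` span a subspace on which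
`uᵀJu = −Σκᵢuᵢ² + ⟨w,u⟩² + ⟨v,u⟩² > 0`. [cite: BronskiDeVillePark2012, §2.2 Prop. 2.1 and Theorem 2.2 (arXiv:1111.5302 p0005 L150–p0006 L100); HornJohnson2013, Corollary 4.2.12] -/
theorem card_rowSum_neg_le_card_eigenvalues_pos (hW : W.IsHermitian) (hc : 0 < c)
    (hWQ : ∀ x : Fin n → ℝ,
      x ⬝ᵥ W *ᵥ x = -(c * ∑ i, x i * ∑ j, Real.cos (θ i - θ j) * (x i - x j))) :
    (univ.filter fun i => ∑ j, Real.cos (θ i - θ j) < 0).card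
      ≤ (univ.filter fun i => 0 < hW.eigenvalues i).card := by
  classical
  let V : Matrix (Fin n) {i // ∑ j, Real.cos (θ i - θ j) < 0} ℝ :=
    fun i p => if i = p.1 then 1 else 0
  have hV : ∀ (e : {i // ∑ j, Real.cos (θ i - θ j) < 0} → ℝ) (i : Fin n),
      (V *ᵥ e) i = if h : ∑ j, Real.cos (θ i - θ j) < 0 then e ⟨i, h⟩ else 0 := by
    intro e i
    simp only [V, mulVec, dotProduct, boole_mul]
    split_ifs with h
    · rw [Finset.sum_eq_single ⟨i, h⟩]
      · rw [if_pos rfl]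
      · intro p _ hp
        rw [if_neg]
        intro hi
        exact hp (Subtype.ext hi.symm)
      · intro hn
        exact absurd (Finset.mem_univ _) hn
    · refine Finset.sum_eq_zero fun p _ => ?_
      rw [if_neg]
      intro hi
      exact h (hi ▸ p.2)
  have h := Literature.Analysis.Matrix.EigenvalueCount.card_le_card_eigenvalues_gt hW V (θ := 0)
    (fun e he => ?_)
  · rwa [Fintype.card_subtype] at h
  set x := V *ᵥ e with hx
  have hQ : ∑ i, x i * ∑ j, Real.cos (θ i - θ j) * (x i - x j)
      ≤ ∑ i, (∑ j, Real.cos (θ i - θ j)) * x i ^ 2 := by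
    rw [allToAll_linForm_eq]
    nlinarith [sq_nonneg (∑ i, Real.cos (θ i) * x i), sq_nonneg (∑ i, Real.sin (θ i) * x i)]
  have hterms : ∀ i, (∑ j, Real.cos (θ i - θ j)) * x i ^ 2 ≤ 0 := by
    intro i
    rw [hx, hV]
    split_ifs with h
    · nlinarith [sq_nonneg (e ⟨i, h⟩)]
    · simp
  obtain ⟨p, hp⟩ := Function.ne_iff.mp he
  have hp' : e p ≠ 0 := hp
  have hpt : (∑ j, Real.cos (θ p.1 - θ j)) * x p.1 ^ 2 < 0 := by
    rw [hx, hV, dif_pos p.2]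
    exact mul_neg_of_neg_of_pos p.2 (by positivity)
  have hsum : ∑ i, (∑ j, Real.cos (θ i - θ j)) * x i ^ 2 < 0 := by
    rw [← Finset.add_sum_erase _ _ (Finset.mem_univ p.1)]
    have : ∑ i ∈ univ.erase p.1, (∑ j, Real.cos (θ i - θ j)) * x i ^ 2 ≤ 0 :=
      Finset.sum_nonpos fun i _ => hterms i
    linarith
  rw [zero_mul, hWQ]
  have : 0 < c * -(∑ i, x i * ∑ j, Real.cos (θ i - θ j) * (x i - x j)) := mul_pos hc (by linarith)
  linarith

/-- **`n₊(J) ≥ n₊(−D) + 1` when `τ > 2`**: adjoin the direction `D⁻¹U(−b, a) = σ/κ` (the vector `x`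
of eq. (x) at the crossing); on the span the form is `−Σ_{κᵢ<0} κᵢeᵢ² − t²·(Σκ)(τ − 2)·… < 0` for `Q`.
[cite: BronskiDeVillePark2012, §2.2 Theorem 2.2 («if this quantity is positive a single eigenvalue has crossed into the right half-plane») (arXiv:1111.5302 p0006 L80–L100); HornJohnson2013, Corollary 4.2.12] -/
theorem card_rowSum_neg_succ_le_card_eigenvalues_pos (hW : W.IsHermitian) (hc : 0 < c)
    (hWQ : ∀ x : Fin n → ℝ,
      x ⬝ᵥ W *ᵥ x = -(c * ∑ i, x i * ∑ j, Real.cos (θ i - θ j) * (x i - x j)))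
    (hκ : ∀ i, ∑ j, Real.cos (θ i - θ j) ≠ 0)
    (hτ : 2 < ∑ i, 1 / ∑ j, Real.cos (θ i - θ j)) :
    (univ.filter fun i => ∑ j, Real.cos (θ i - θ j) < 0).card + 1
      ≤ (univ.filter fun i => 0 < hW.eigenvalues i).card := by
  classical
  rcases isEmpty_or_nonempty (Fin n) with hn | hn
  · simp at hτ; linarith
  -- `R² = Σκ = a² + b² > 0`
  have hR2 : ∑ i, ∑ j, Real.cos (θ i - θ j) = (∑ j, Real.cos (θ j)) ^ 2 + (∑ j, Real.sin (θ j)) ^ 2 :=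
    sum_sum_cos_sub_eq θ
  have hRpos : 0 < ∑ i, ∑ j, Real.cos (θ i - θ j) := by
    rcases (hR2 ▸ add_nonneg (sq_nonneg _) (sq_nonneg _) :
      0 ≤ ∑ i, ∑ j, Real.cos (θ i - θ j)).lt_or_eq with h | h
    · exact h
    · exfalso
      have ha : ∑ j, Real.cos (θ j) = 0 := by nlinarith [sq_nonneg (∑ j, Real.cos (θ j)), sq_nonneg (∑ j, Real.sin (θ j))]
      have hb : ∑ j, Real.sin (θ j) = 0 := by nlinarith [sq_nonneg (∑ j, Real.cos (θ j)), sq_nonneg (∑ j, Real.sin (θ j))]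
      obtain ⟨i⟩ := hn
      apply hκ i
      rw [rowSum_cos_eq, ha, hb]; ring
  let V : Matrix (Fin n) ({i // ∑ j, Real.cos (θ i - θ j) < 0} ⊕ Unit) ℝ :=
    fun i q => match q with
      | Sum.inl p => if i = p.1 then 1 else 0
      | Sum.inr _ => (∑ j, Real.sin (θ i - θ j)) / ∑ j, Real.cos (θ i - θ j)
  have hV : ∀ (e : {i // ∑ j, Real.cos (θ i - θ j) < 0} ⊕ Unit → ℝ) (i : Fin n),
      (V *ᵥ e) i = (if h : ∑ j, Real.cos (θ i - θ j) < 0 then e (Sum.inl ⟨i, h⟩) else 0)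
        + (∑ j, Real.sin (θ i - θ j)) / (∑ j, Real.cos (θ i - θ j)) * e (Sum.inr ()) := by
    intro e i
    simp only [V, mulVec, dotProduct, Fintype.sum_sum_type, Fintype.sum_unique, boole_mul]
    congr 1
    split_ifs with h
    · rw [Finset.sum_eq_single ⟨i, h⟩]
      · rw [if_pos rfl]
      · intro p _ hp
        rw [if_neg]
        intro hi
        exact hp (Subtype.ext hi.symm)
      · intro hn'
        exact absurd (Finset.mem_univ _) hn'
    · refine Finset.sum_eq_zero fun p _ => ?_
      rw [if_neg]
      intro hi
      exact h (hi ▸ p.2)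
  have h := Literature.Analysis.Matrix.EigenvalueCount.card_le_card_eigenvalues_gt hW V (θ := 0)
    (fun e he => ?_)
  · rwa [Fintype.card_sum, Fintype.card_subtype, Fintype.card_unique] at h
  set x := V *ᵥ e with hx
  set t := e (Sum.inr ()) with ht
  set ext : Fin n → ℝ := fun i =>
    if h : ∑ j, Real.cos (θ i - θ j) < 0 then e (Sum.inl ⟨i, h⟩) else 0 with hext
  -- `d = t(−b, a)`: `(Ud)ᵢ = t σᵢ`, so `xᵢ − (Ud)ᵢ/κᵢ = extᵢ`
  have hsplit := allToAll_linForm_eq_split θ x (t * -(∑ j, Real.sin (θ j))) (t * ∑ j, Real.cos (θ j)) hκ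
  have hg : ∀ i, t * -(∑ j, Real.sin (θ j)) * Real.cos (θ i) + t * (∑ j, Real.cos (θ j)) * Real.sin (θ i)
      = t * ∑ j, Real.sin (θ i - θ j) := by
    intro i
    rw [rowSum_sin_eq]; ring
  have hxe : ∀ i, x i - (t * -(∑ j, Real.sin (θ j)) * Real.cos (θ i)
      + t * (∑ j, Real.cos (θ j)) * Real.sin (θ i)) / ∑ j, Real.cos (θ i - θ j) = ext i := by
    intro i
    rw [hg i, hx, hV, ← ht]
    have hk := hκ i
    field_simp
    ring
  simp only [hxe] at hsplit
  have hM := rankTwo_form_eq θ (t * -(∑ j, Real.sin (θ j))) (t * ∑ j, Real.cos (θ j)) hκ hRpos.ne'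
  have hMval : (∑ i, 1 / ∑ j, Real.cos (θ i - θ j) - 2)
      * ((∑ j, Real.cos (θ j)) * (t * ∑ j, Real.cos (θ j))
        - (∑ j, Real.sin (θ j)) * (t * -(∑ j, Real.sin (θ j)))) ^ 2 / ∑ i, ∑ j, Real.cos (θ i - θ j)
      = (∑ i, 1 / ∑ j, Real.cos (θ i - θ j) - 2) * t ^ 2 * ∑ i, ∑ j, Real.cos (θ i - θ j) := by
    rw [div_eq_iff hRpos.ne', hR2]
    ring
  rw [hMval] at hM
  -- `Q(x) ≤ Σκ extᵢ² − (τ − 2)t²R² < 0`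
  have hterms : ∀ i, (∑ j, Real.cos (θ i - θ j)) * ext i ^ 2 ≤ 0 := by
    intro i
    simp only [hext]
    split_ifs with h
    · nlinarith [sq_nonneg (e (Sum.inl ⟨i, h⟩))]
    · simp
  have hS : ∑ i, (∑ j, Real.cos (θ i - θ j)) * ext i ^ 2 ≤ 0 := Finset.sum_nonpos fun i _ => hterms i
  have hT2 : 0 ≤ (∑ i, 1 / ∑ j, Real.cos (θ i - θ j) - 2) * t ^ 2 * ∑ i, ∑ j, Real.cos (θ i - θ j) :=
    mul_nonneg (mul_nonneg (by linarith) (sq_nonneg _)) hRpos.le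
  have hlast : 0 ≤ (t * -(∑ j, Real.sin (θ j)) - ∑ i, Real.cos (θ i) * x i) ^ 2
      + (t * (∑ j, Real.cos (θ j)) - ∑ i, Real.sin (θ i) * x i) ^ 2 := by positivity
  -- strictness: `e ≠ 0` ⇒ `t ≠ 0` or some `e (inl p) ≠ 0`
  have hstrict : ∑ i, (∑ j, Real.cos (θ i - θ j)) * ext i ^ 2
      - (∑ i, 1 / ∑ j, Real.cos (θ i - θ j) - 2) * t ^ 2 * ∑ i, ∑ j, Real.cos (θ i - θ j) < 0 := by
    by_cases ht0 : t = 0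
    · obtain ⟨q, hq⟩ := Function.ne_iff.mp he
      have hq' : e q ≠ 0 := hq
      rcases q with p | u
      · have hpt : (∑ j, Real.cos (θ p.1 - θ j)) * ext p.1 ^ 2 < 0 := by
          simp only [hext, dif_pos p.2]
          exact mul_neg_of_neg_of_pos p.2 (by positivity)
        have hsum : ∑ i, (∑ j, Real.cos (θ i - θ j)) * ext i ^ 2 < 0 := by
          rw [← Finset.add_sum_erase _ _ (Finset.mem_univ p.1)]
          have : ∑ i ∈ univ.erase p.1, (∑ j, Real.cos (θ i - θ j)) * ext i ^ 2 ≤ 0 :=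
            Finset.sum_nonpos fun i _ => hterms i
          linarith
        linarith
      · exact absurd ht0 (by simpa using hq')
    · have : 0 < (∑ i, 1 / ∑ j, Real.cos (θ i - θ j) - 2) * t ^ 2 * ∑ i, ∑ j, Real.cos (θ i - θ j) :=
        mul_pos (mul_pos (by linarith) (by positivity)) hRpos
      linarith
  rw [zero_mul, hWQ, hsplit, hM]
  have : 0 < c * -(∑ i, (∑ j, Real.cos (θ i - θ j)) * ext i ^ 2
      - (∑ i, 1 / ∑ j, Real.cos (θ i - θ j) - 2) * t ^ 2 * ∑ i, ∑ j, Real.cos (θ i - θ j)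
      - ((t * -(∑ j, Real.sin (θ j)) - ∑ i, Real.cos (θ i) * x i) ^ 2
        + (t * (∑ j, Real.cos (θ j)) - ∑ i, Real.sin (θ i) * x i) ^ 2)) := mul_pos hc (by linarith)
  linarith

/-- `Σκ = a² + b² > 0` as soon as the row sums are non-zero (`n ≥ 1`). [cite: BronskiDeVillePark2012, §2.2 Theorem 2.2 (hypothesis «`D` is invertible») (arXiv:1111.5302 p0006 L22)] -/
theorem sum_sum_cos_pos_of_rowSum_ne_zero [Nonempty (Fin n)]
    (hκ : ∀ i, ∑ j, Real.cos (θ i - θ j) ≠ 0) : 0 < ∑ i, ∑ j, Real.cos (θ i - θ j) := by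
  have hR2 : ∑ i, ∑ j, Real.cos (θ i - θ j) = (∑ j, Real.cos (θ j)) ^ 2 + (∑ j, Real.sin (θ j)) ^ 2 :=
    sum_sum_cos_sub_eq θ
  rcases (hR2 ▸ add_nonneg (sq_nonneg _) (sq_nonneg _) :
    0 ≤ ∑ i, ∑ j, Real.cos (θ i - θ j)).lt_or_eq with h | h
  · exact h
  · exfalso
    have ha : ∑ j, Real.cos (θ j) = 0 := by
      nlinarith [sq_nonneg (∑ j, Real.cos (θ j)), sq_nonneg (∑ j, Real.sin (θ j))]
    have hb : ∑ j, Real.sin (θ j) = 0 := by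
      nlinarith [sq_nonneg (∑ j, Real.cos (θ j)), sq_nonneg (∑ j, Real.sin (θ j))]
    obtain ⟨i⟩ := (inferInstance : Nonempty (Fin n))
    apply hκ i
    rw [rowSum_cos_eq, ha, hb]; ring

/-- **The configurations with `κᵢxᵢ = (UUᵀx)ᵢ` for all `i`, `⟨(−b, a), Uᵀx⟩ = 0` and `⟨κ, x⟩ = 0`
reduce to `x = 0`** (the kernel of `J` is the rotation `𝟙` only). [cite: BronskiDeVillePark2012, §2.2 Theorem 2.2 («Since … one of the eigenvalues of the Jacobian is zero …») (arXiv:1111.5302 p0006 L18–L20)] -/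
theorem eq_zero_of_fixed_of_orderParam [Nonempty (Fin n)] (hκ : ∀ i, ∑ j, Real.cos (θ i - θ j) ≠ 0)
    {x : Fin n → ℝ}
    (hfix : ∀ i, (∑ j, Real.cos (θ i - θ j)) * x i
      = (∑ j, Real.cos (θ j) * x j) * Real.cos (θ i) + (∑ j, Real.sin (θ j) * x j) * Real.sin (θ i))
    (hβ : (∑ j, Real.cos (θ j)) * (∑ j, Real.sin (θ j) * x j)
      - (∑ j, Real.sin (θ j)) * (∑ j, Real.cos (θ j) * x j) = 0)
    (hK : ∑ i, (∑ j, Real.cos (θ i - θ j)) * x i = 0) : x = 0 := by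
  have hRpos := sum_sum_cos_pos_of_rowSum_ne_zero hκ
  have hR2 : ∑ i, ∑ j, Real.cos (θ i - θ j) = (∑ j, Real.cos (θ j)) ^ 2 + (∑ j, Real.sin (θ j)) ^ 2 :=
    sum_sum_cos_sub_eq θ
  have hα : (∑ j, Real.cos (θ j)) * (∑ j, Real.cos (θ j) * x j)
      + (∑ j, Real.sin (θ j)) * (∑ j, Real.sin (θ j) * x j) = 0 := by
    rw [← sum_rowSum_cos_mul_eq θ x]; exact hK
  have hA : ∑ j, Real.cos (θ j) * x j = 0 := by
    have h1 : (∑ i, ∑ j, Real.cos (θ i - θ j)) * ∑ j, Real.cos (θ j) * x j = 0 := by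
      rw [hR2]
      linear_combination (∑ j, Real.cos (θ j)) * hα - (∑ j, Real.sin (θ j)) * hβ
    rcases mul_eq_zero.1 h1 with h | h
    · exact absurd h hRpos.ne'
    · exact h
  have hB : ∑ j, Real.sin (θ j) * x j = 0 := by
    have h1 : (∑ i, ∑ j, Real.cos (θ i - θ j)) * ∑ j, Real.sin (θ j) * x j = 0 := by
      rw [hR2]
      linear_combination (∑ j, Real.sin (θ j)) * hα + (∑ j, Real.cos (θ j)) * hβ
    rcases mul_eq_zero.1 h1 with h | h
    · exact absurd h hRpos.ne'
    · exact h
  funext i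
  have h := hfix i
  rw [hA, hB, zero_mul, zero_mul, add_zero] at h
  rcases mul_eq_zero.1 h with h | h
  · exact absurd h (hκ i)
  · exact h

/-- **On the constraint set `κᵢxᵢ = (UUᵀx)ᵢ` for every `i` with `κᵢ < 0` the form `Q` is bounded
below by `−dᵀM₁d` at `d = Uᵀx`** (`Q(x) = Σ_{κᵢ>0} κᵢ(xᵢ − (Ud)ᵢ/κᵢ)² − dᵀM₁d ≥ −dᵀM₁d`), and
`Q(x) = −dᵀM₁d` forces `κᵢxᵢ = (Ud)ᵢ` for all `i`. [cite: BronskiDeVillePark2012, §2.2 Theorem 2.2, proof (arXiv:1111.5302 p0006 L30–L100)] -/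
theorem allToAll_linForm_ge_of_constraint (hκ : ∀ i, ∑ j, Real.cos (θ i - θ j) ≠ 0)
    (hR : ∑ i, ∑ j, Real.cos (θ i - θ j) ≠ 0) {x : Fin n → ℝ}
    (hfixN : ∀ i, ∑ j, Real.cos (θ i - θ j) < 0 → (∑ j, Real.cos (θ i - θ j)) * x i
      = (∑ j, Real.cos (θ j) * x j) * Real.cos (θ i) + (∑ j, Real.sin (θ j) * x j) * Real.sin (θ i)) :
    -((∑ i, 1 / ∑ j, Real.cos (θ i - θ j) - 2)
        * ((∑ j, Real.cos (θ j)) * (∑ j, Real.sin (θ j) * x j)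
          - (∑ j, Real.sin (θ j)) * (∑ j, Real.cos (θ j) * x j)) ^ 2
        / ∑ i, ∑ j, Real.cos (θ i - θ j))
      ≤ ∑ i, x i * ∑ j, Real.cos (θ i - θ j) * (x i - x j)
    ∧ (∑ i, x i * ∑ j, Real.cos (θ i - θ j) * (x i - x j)
        = -((∑ i, 1 / ∑ j, Real.cos (θ i - θ j) - 2)
          * ((∑ j, Real.cos (θ j)) * (∑ j, Real.sin (θ j) * x j)
            - (∑ j, Real.sin (θ j)) * (∑ j, Real.cos (θ j) * x j)) ^ 2
          / ∑ i, ∑ j, Real.cos (θ i - θ j)) →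
      ∀ i, (∑ j, Real.cos (θ i - θ j)) * x i
        = (∑ j, Real.cos (θ j) * x j) * Real.cos (θ i) + (∑ j, Real.sin (θ j) * x j) * Real.sin (θ i)) := by
  have hsplit := allToAll_linForm_eq_split θ x (∑ j, Real.cos (θ j) * x j) (∑ j, Real.sin (θ j) * x j) hκ
  have hM := rankTwo_form_eq θ (∑ j, Real.cos (θ j) * x j) (∑ j, Real.sin (θ j) * x j) hκ hR
  rw [hM, sub_self, sub_self] at hsplit
  simp only [ne_eq, OfNat.ofNat_ne_zero, not_false_eq_true, zero_pow, add_zero, sub_zero] at hsplit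
  -- the square terms
  have hterm : ∀ i, 0 ≤ (∑ j, Real.cos (θ i - θ j))
      * (x i - ((∑ j, Real.cos (θ j) * x j) * Real.cos (θ i)
        + (∑ j, Real.sin (θ j) * x j) * Real.sin (θ i)) / ∑ j, Real.cos (θ i - θ j)) ^ 2 := by
    intro i
    rcases lt_or_gt_of_ne (hκ i) with h | h
    · have e : x i - ((∑ j, Real.cos (θ j) * x j) * Real.cos (θ i)
          + (∑ j, Real.sin (θ j) * x j) * Real.sin (θ i)) / ∑ j, Real.cos (θ i - θ j) = 0 := by
        rw [sub_eq_zero, eq_div_iff (hκ i), ← hfixN i h, mul_comm]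
      rw [e]; simp
    · exact mul_nonneg h.le (sq_nonneg _)
  have hS : 0 ≤ ∑ i, (∑ j, Real.cos (θ i - θ j))
      * (x i - ((∑ j, Real.cos (θ j) * x j) * Real.cos (θ i)
        + (∑ j, Real.sin (θ j) * x j) * Real.sin (θ i)) / ∑ j, Real.cos (θ i - θ j)) ^ 2 :=
    Finset.sum_nonneg fun i _ => hterm i
  refine ⟨by rw [hsplit]; linarith, fun hQ i => ?_⟩
  rw [hsplit] at hQ
  have hS0 : ∑ i, (∑ j, Real.cos (θ i - θ j))
      * (x i - ((∑ j, Real.cos (θ j) * x j) * Real.cos (θ i)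
        + (∑ j, Real.sin (θ j) * x j) * Real.sin (θ i)) / ∑ j, Real.cos (θ i - θ j)) ^ 2 = 0 := by
    linarith
  have hi := (Finset.sum_eq_zero_iff_of_nonneg fun i _ => hterm i).1 hS0 i (Finset.mem_univ i)
  rcases mul_eq_zero.1 hi with h | h
  · exact absurd h (hκ i)
  · have h' := pow_eq_zero_iff two_ne_zero |>.1 h
    rw [sub_eq_zero, eq_div_iff (hκ i), mul_comm] at h'
    exact h'

/-- **`n₊(J) ≤ n₊(−D)` when `τ ≤ 2`**: on the `n − n₊(−D)`-dimensional constraint set `Q ≥ −dᵀM₁d ≥ 0`.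
[cite: BronskiDeVillePark2012, §2.2 Theorem 2.2 («If this is negative there have been no eigenvalue crossings») (arXiv:1111.5302 p0006 L80–L100); HornJohnson2013, Theorem 4.2.10] -/
theorem card_eigenvalues_pos_le_card_rowSum_neg (hW : W.IsHermitian) (hc : 0 < c)
    (hWQ : ∀ x : Fin n → ℝ,
      x ⬝ᵥ W *ᵥ x = -(c * ∑ i, x i * ∑ j, Real.cos (θ i - θ j) * (x i - x j)))
    (hκ : ∀ i, ∑ j, Real.cos (θ i - θ j) ≠ 0)
    (hτ : ∑ i, 1 / ∑ j, Real.cos (θ i - θ j) ≤ 2) :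
    (univ.filter fun i => 0 < hW.eigenvalues i).card
      ≤ (univ.filter fun i => ∑ j, Real.cos (θ i - θ j) < 0).card := by
  classical
  rcases isEmpty_or_nonempty (Fin n) with hn | hn
  · simp
  have hRpos := sum_sum_cos_pos_of_rowSum_ne_zero hκ
  let L : (Fin n → ℝ) →ₗ[ℝ] ({i // ∑ j, Real.cos (θ i - θ j) < 0} → ℝ) :=
    { toFun := fun x p => (∑ j, Real.cos (θ p.1 - θ j)) * x p.1
        - ((∑ j, Real.cos (θ j) * x j) * Real.cos (θ p.1) + (∑ j, Real.sin (θ j) * x j) * Real.sin (θ p.1))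
      map_add' := fun x y => by
        funext p
        simp only [Pi.add_apply, mul_add, Finset.sum_add_distrib]
        ring
      map_smul' := fun r x => by
        funext p
        simp only [Pi.smul_apply, smul_eq_mul, RingHom.id_apply]
        rw [show ∑ j, Real.cos (θ j) * (r * x j) = r * ∑ j, Real.cos (θ j) * x j by
              rw [Finset.mul_sum]; exact Finset.sum_congr rfl fun j _ => by ring,
            show ∑ j, Real.sin (θ j) * (r * x j) = r * ∑ j, Real.sin (θ j) * x j by
              rw [Finset.mul_sum]; exact Finset.sum_congr rfl fun j _ => by ring]
        ring }
  refine card_eigenvalues_pos_le_of_nonpos_on_ker hW L (le_of_eq ?_) fun x hx => ?_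
  · rw [Module.finrank_fintype_fun_eq_card, Fintype.card_subtype]
  have hfixN : ∀ i, ∑ j, Real.cos (θ i - θ j) < 0 → (∑ j, Real.cos (θ i - θ j)) * x i
      = (∑ j, Real.cos (θ j) * x j) * Real.cos (θ i) + (∑ j, Real.sin (θ j) * x j) * Real.sin (θ i) := by
    intro i hi
    have := congrFun hx ⟨i, hi⟩
    simpa [L, sub_eq_zero] using this
  have hge := (allToAll_linForm_ge_of_constraint hκ hRpos.ne' hfixN).1
  have hM1 : 0 ≤ -((∑ i, 1 / ∑ j, Real.cos (θ i - θ j) - 2)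
      * ((∑ j, Real.cos (θ j)) * (∑ j, Real.sin (θ j) * x j)
        - (∑ j, Real.sin (θ j)) * (∑ j, Real.cos (θ j) * x j)) ^ 2
      / ∑ i, ∑ j, Real.cos (θ i - θ j)) := by
    rw [neg_div', neg_mul_eq_neg_mul, neg_sub]
    exact div_nonneg (mul_nonneg (by linarith) (sq_nonneg _)) hRpos.le
  rw [hWQ]
  have : 0 ≤ c * ∑ i, x i * ∑ j, Real.cos (θ i - θ j) * (x i - x j) := mul_nonneg hc.le (by linarith)
  linarith

/-- **`n₊(J) ≤ n₊(−D) + 1` always** (one more constraint, `⟨(−b,a), Uᵀx⟩ = 0`, kills `dᵀM₁d`).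
[cite: BronskiDeVillePark2012, §2.2 («the indices of `J` and `D` can differ by at most two … only one eigenvalue whose sign is to be determined») (arXiv:1111.5302 p0005 L136–p0006 L20); HornJohnson2013, Theorem 4.2.10] -/
theorem card_eigenvalues_pos_le_card_rowSum_neg_succ (hW : W.IsHermitian) (hc : 0 < c)
    (hWQ : ∀ x : Fin n → ℝ,
      x ⬝ᵥ W *ᵥ x = -(c * ∑ i, x i * ∑ j, Real.cos (θ i - θ j) * (x i - x j)))
    (hκ : ∀ i, ∑ j, Real.cos (θ i - θ j) ≠ 0) :
    (univ.filter fun i => 0 < hW.eigenvalues i).card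
      ≤ (univ.filter fun i => ∑ j, Real.cos (θ i - θ j) < 0).card + 1 := by
  classical
  rcases isEmpty_or_nonempty (Fin n) with hn | hn
  · simp
  have hRpos := sum_sum_cos_pos_of_rowSum_ne_zero hκ
  let L : (Fin n → ℝ) →ₗ[ℝ] ({i // ∑ j, Real.cos (θ i - θ j) < 0} → ℝ) × ℝ :=
    { toFun := fun x => (fun p => (∑ j, Real.cos (θ p.1 - θ j)) * x p.1
        - ((∑ j, Real.cos (θ j) * x j) * Real.cos (θ p.1) + (∑ j, Real.sin (θ j) * x j) * Real.sin (θ p.1)),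
        (∑ j, Real.cos (θ j)) * (∑ j, Real.sin (θ j) * x j)
          - (∑ j, Real.sin (θ j)) * (∑ j, Real.cos (θ j) * x j))
      map_add' := fun x y => by
        ext p
        · simp only [Pi.add_apply, mul_add, Finset.sum_add_distrib, Prod.fst_add]
          ring
        · simp only [Pi.add_apply, mul_add, Finset.sum_add_distrib, Prod.snd_add]
          ring
      map_smul' := fun r x => by
        ext p
        · simp only [Pi.smul_apply, smul_eq_mul, RingHom.id_apply, Prod.smul_fst]
          rw [show ∑ j, Real.cos (θ j) * (r * x j) = r * ∑ j, Real.cos (θ j) * x j by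
                rw [Finset.mul_sum]; exact Finset.sum_congr rfl fun j _ => by ring,
              show ∑ j, Real.sin (θ j) * (r * x j) = r * ∑ j, Real.sin (θ j) * x j by
                rw [Finset.mul_sum]; exact Finset.sum_congr rfl fun j _ => by ring]
          ring
        · simp only [Pi.smul_apply, smul_eq_mul, RingHom.id_apply, Prod.smul_snd]
          rw [show ∑ j, Real.cos (θ j) * (r * x j) = r * ∑ j, Real.cos (θ j) * x j by
                rw [Finset.mul_sum]; exact Finset.sum_congr rfl fun j _ => by ring,
              show ∑ j, Real.sin (θ j) * (r * x j) = r * ∑ j, Real.sin (θ j) * x j by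
                rw [Finset.mul_sum]; exact Finset.sum_congr rfl fun j _ => by ring]
          ring }
  refine card_eigenvalues_pos_le_of_nonpos_on_ker hW L (le_of_eq ?_) fun x hx => ?_
  · rw [Module.finrank_prod, Module.finrank_fintype_fun_eq_card, Fintype.card_subtype,
      Module.finrank_self]
  have hx1 := congrArg Prod.fst hx
  have hx2 : (∑ j, Real.cos (θ j)) * (∑ j, Real.sin (θ j) * x j)
      - (∑ j, Real.sin (θ j)) * (∑ j, Real.cos (θ j) * x j) = 0 := by
    have := congrArg Prod.snd hx
    simpa [L] using this
  have hfixN : ∀ i, ∑ j, Real.cos (θ i - θ j) < 0 → (∑ j, Real.cos (θ i - θ j)) * x i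
      = (∑ j, Real.cos (θ j) * x j) * Real.cos (θ i) + (∑ j, Real.sin (θ j) * x j) * Real.sin (θ i) := by
    intro i hi
    have := congrFun hx1 ⟨i, hi⟩
    simpa [L, sub_eq_zero] using this
  have hge := (allToAll_linForm_ge_of_constraint hκ hRpos.ne' hfixN).1
  rw [hx2] at hge
  simp only [ne_eq, OfNat.ofNat_ne_zero, not_false_eq_true, zero_pow, mul_zero, zero_div,
    neg_zero] at hge
  rw [hWQ]
  have : 0 ≤ c * ∑ i, x i * ∑ j, Real.cos (θ i - θ j) * (x i - x j) := mul_nonneg hc.le hge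
  linarith

/-- **Strict count, `τ < 2`: at most `n₊(−D) + 1` eigenvalues `≥ 0`** (the extra constraint
`⟨κ, x⟩ = 0` removes the rotation; on the rest `Q > 0`). [cite: BronskiDeVillePark2012, §2.2 Theorem 2.2 (arXiv:1111.5302 p0006); HornJohnson2013, Theorem 4.2.10] -/
theorem card_eigenvalues_nonneg_le_card_rowSum_neg_succ (hW : W.IsHermitian) (hc : 0 < c)
    (hWQ : ∀ x : Fin n → ℝ,
      x ⬝ᵥ W *ᵥ x = -(c * ∑ i, x i * ∑ j, Real.cos (θ i - θ j) * (x i - x j)))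
    (hκ : ∀ i, ∑ j, Real.cos (θ i - θ j) ≠ 0)
    (hτ : ∑ i, 1 / ∑ j, Real.cos (θ i - θ j) < 2) :
    (univ.filter fun i => 0 ≤ hW.eigenvalues i).card
      ≤ (univ.filter fun i => ∑ j, Real.cos (θ i - θ j) < 0).card + 1 := by
  classical
  rcases isEmpty_or_nonempty (Fin n) with hn | hn
  · simp
  have hRpos := sum_sum_cos_pos_of_rowSum_ne_zero hκ
  let L : (Fin n → ℝ) →ₗ[ℝ] ({i // ∑ j, Real.cos (θ i - θ j) < 0} → ℝ) × ℝ :=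
    { toFun := fun x => (fun p => (∑ j, Real.cos (θ p.1 - θ j)) * x p.1
        - ((∑ j, Real.cos (θ j) * x j) * Real.cos (θ p.1) + (∑ j, Real.sin (θ j) * x j) * Real.sin (θ p.1)),
        ∑ i, (∑ j, Real.cos (θ i - θ j)) * x i)
      map_add' := fun x y => by
        ext p
        · simp only [Pi.add_apply, mul_add, Finset.sum_add_distrib, Prod.fst_add]
          ring
        · simp only [Pi.add_apply, mul_add, Finset.sum_add_distrib, Prod.snd_add]
      map_smul' := fun r x => by
        ext p
        · simp only [Pi.smul_apply, smul_eq_mul, RingHom.id_apply, Prod.smul_fst]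
          rw [show ∑ j, Real.cos (θ j) * (r * x j) = r * ∑ j, Real.cos (θ j) * x j by
                rw [Finset.mul_sum]; exact Finset.sum_congr rfl fun j _ => by ring,
              show ∑ j, Real.sin (θ j) * (r * x j) = r * ∑ j, Real.sin (θ j) * x j by
                rw [Finset.mul_sum]; exact Finset.sum_congr rfl fun j _ => by ring]
          ring
        · simp only [Pi.smul_apply, smul_eq_mul, RingHom.id_apply, Prod.smul_snd]
          rw [Finset.mul_sum]
          exact Finset.sum_congr rfl fun j _ => by ring }
  refine card_eigenvalues_nonneg_le_of_neg_on_ker hW L (le_of_eq ?_) fun x hx0 hx => ?_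
  · rw [Module.finrank_prod, Module.finrank_fintype_fun_eq_card, Fintype.card_subtype,
      Module.finrank_self]
  have hx1 := congrArg Prod.fst hx
  have hK : ∑ i, (∑ j, Real.cos (θ i - θ j)) * x i = 0 := by
    have := congrArg Prod.snd hx
    simpa [L] using this
  have hfixN : ∀ i, ∑ j, Real.cos (θ i - θ j) < 0 → (∑ j, Real.cos (θ i - θ j)) * x i
      = (∑ j, Real.cos (θ j) * x j) * Real.cos (θ i) + (∑ j, Real.sin (θ j) * x j) * Real.sin (θ i) := by
    intro i hi
    have := congrFun hx1 ⟨i, hi⟩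
    simpa [L, sub_eq_zero] using this
  obtain ⟨hge, hfix⟩ := allToAll_linForm_ge_of_constraint hκ hRpos.ne' hfixN
  have hM1 : 0 ≤ -((∑ i, 1 / ∑ j, Real.cos (θ i - θ j) - 2)
      * ((∑ j, Real.cos (θ j)) * (∑ j, Real.sin (θ j) * x j)
        - (∑ j, Real.sin (θ j)) * (∑ j, Real.cos (θ j) * x j)) ^ 2
      / ∑ i, ∑ j, Real.cos (θ i - θ j)) := by
    rw [neg_div', neg_mul_eq_neg_mul, neg_sub]
    exact div_nonneg (mul_nonneg (by linarith) (sq_nonneg _)) hRpos.le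
  -- `Q(x) > 0`: otherwise `Q = −dᵀM₁d = 0`, the fixed-point equations hold and `x = 0`
  have hQpos : 0 < ∑ i, x i * ∑ j, Real.cos (θ i - θ j) * (x i - x j) := by
    by_contra hle
    push Not at hle
    have hQ0 : ∑ i, x i * ∑ j, Real.cos (θ i - θ j) * (x i - x j)
        = -((∑ i, 1 / ∑ j, Real.cos (θ i - θ j) - 2)
          * ((∑ j, Real.cos (θ j)) * (∑ j, Real.sin (θ j) * x j)
            - (∑ j, Real.sin (θ j)) * (∑ j, Real.cos (θ j) * x j)) ^ 2
          / ∑ i, ∑ j, Real.cos (θ i - θ j)) := by linarith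
    have hβ0 : (∑ j, Real.cos (θ j)) * (∑ j, Real.sin (θ j) * x j)
        - (∑ j, Real.sin (θ j)) * (∑ j, Real.cos (θ j) * x j) = 0 := by
      have h0 : (∑ i, 1 / ∑ j, Real.cos (θ i - θ j) - 2)
          * ((∑ j, Real.cos (θ j)) * (∑ j, Real.sin (θ j) * x j)
            - (∑ j, Real.sin (θ j)) * (∑ j, Real.cos (θ j) * x j)) ^ 2
          / ∑ i, ∑ j, Real.cos (θ i - θ j) = 0 := by linarith
      rw [div_eq_zero_iff] at h0
      rcases h0 with h0 | h0
      · rcases mul_eq_zero.1 h0 with h0 | h0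
        · exact absurd h0 (by linarith)
        · exact pow_eq_zero_iff two_ne_zero |>.1 h0
      · exact absurd h0 hRpos.ne'
    exact hx0 (eq_zero_of_fixed_of_orderParam hκ (hfix hQ0) hβ0 hK)
  rw [hWQ]
  have : 0 < c * ∑ i, x i * ∑ j, Real.cos (θ i - θ j) * (x i - x j) := mul_pos hc hQpos
  linarith

/-- **Strict count, `τ > 2`: at most `n₊(−D) + 2` eigenvalues `≥ 0`.**
[cite: BronskiDeVillePark2012, §2.2 Theorem 2.2 (arXiv:1111.5302 p0006); HornJohnson2013, Theorem 4.2.10] -/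
theorem card_eigenvalues_nonneg_le_card_rowSum_neg_add_two (hW : W.IsHermitian) (hc : 0 < c)
    (hWQ : ∀ x : Fin n → ℝ,
      x ⬝ᵥ W *ᵥ x = -(c * ∑ i, x i * ∑ j, Real.cos (θ i - θ j) * (x i - x j)))
    (hκ : ∀ i, ∑ j, Real.cos (θ i - θ j) ≠ 0) :
    (univ.filter fun i => 0 ≤ hW.eigenvalues i).card
      ≤ (univ.filter fun i => ∑ j, Real.cos (θ i - θ j) < 0).card + 2 := by
  classical
  rcases isEmpty_or_nonempty (Fin n) with hn | hn
  · simp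
  have hRpos := sum_sum_cos_pos_of_rowSum_ne_zero hκ
  let L : (Fin n → ℝ) →ₗ[ℝ] (({i // ∑ j, Real.cos (θ i - θ j) < 0} → ℝ) × ℝ) × ℝ :=
    { toFun := fun x => ((fun p => (∑ j, Real.cos (θ p.1 - θ j)) * x p.1
        - ((∑ j, Real.cos (θ j) * x j) * Real.cos (θ p.1) + (∑ j, Real.sin (θ j) * x j) * Real.sin (θ p.1)),
        (∑ j, Real.cos (θ j)) * (∑ j, Real.sin (θ j) * x j)
          - (∑ j, Real.sin (θ j)) * (∑ j, Real.cos (θ j) * x j)),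
        ∑ i, (∑ j, Real.cos (θ i - θ j)) * x i)
      map_add' := fun x y => by
        ext p
        · simp only [Pi.add_apply, mul_add, Finset.sum_add_distrib, Prod.fst_add]
          ring
        · simp only [Pi.add_apply, mul_add, Finset.sum_add_distrib, Prod.fst_add, Prod.snd_add]
          ring
        · simp only [Pi.add_apply, mul_add, Finset.sum_add_distrib, Prod.snd_add]
      map_smul' := fun r x => by
        ext p
        · simp only [Pi.smul_apply, smul_eq_mul, RingHom.id_apply, Prod.smul_fst]
          rw [show ∑ j, Real.cos (θ j) * (r * x j) = r * ∑ j, Real.cos (θ j) * x j by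
                rw [Finset.mul_sum]; exact Finset.sum_congr rfl fun j _ => by ring,
              show ∑ j, Real.sin (θ j) * (r * x j) = r * ∑ j, Real.sin (θ j) * x j by
                rw [Finset.mul_sum]; exact Finset.sum_congr rfl fun j _ => by ring]
          ring
        · simp only [Pi.smul_apply, smul_eq_mul, RingHom.id_apply, Prod.smul_fst, Prod.smul_snd]
          rw [show ∑ j, Real.cos (θ j) * (r * x j) = r * ∑ j, Real.cos (θ j) * x j by
                rw [Finset.mul_sum]; exact Finset.sum_congr rfl fun j _ => by ring,
              show ∑ j, Real.sin (θ j) * (r * x j) = r * ∑ j, Real.sin (θ j) * x j by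
                rw [Finset.mul_sum]; exact Finset.sum_congr rfl fun j _ => by ring]
          ring
        · simp only [Pi.smul_apply, smul_eq_mul, RingHom.id_apply, Prod.smul_snd]
          rw [Finset.mul_sum]
          exact Finset.sum_congr rfl fun j _ => by ring }
  refine card_eigenvalues_nonneg_le_of_neg_on_ker hW L (le_of_eq ?_) fun x hx0 hx => ?_
  · rw [Module.finrank_prod, Module.finrank_prod, Module.finrank_fintype_fun_eq_card,
      Fintype.card_subtype, Module.finrank_self]
  have hx1 := congrArg Prod.fst (congrArg Prod.fst hx)
  have hβ0 : (∑ j, Real.cos (θ j)) * (∑ j, Real.sin (θ j) * x j)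
      - (∑ j, Real.sin (θ j)) * (∑ j, Real.cos (θ j) * x j) = 0 := by
    have := congrArg Prod.snd (congrArg Prod.fst hx)
    simpa [L] using this
  have hK : ∑ i, (∑ j, Real.cos (θ i - θ j)) * x i = 0 := by
    have := congrArg Prod.snd hx
    simpa [L] using this
  have hfixN : ∀ i, ∑ j, Real.cos (θ i - θ j) < 0 → (∑ j, Real.cos (θ i - θ j)) * x i
      = (∑ j, Real.cos (θ j) * x j) * Real.cos (θ i) + (∑ j, Real.sin (θ j) * x j) * Real.sin (θ i) := by
    intro i hi
    have := congrFun hx1 ⟨i, hi⟩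
    simpa [L, sub_eq_zero] using this
  obtain ⟨hge, hfix⟩ := allToAll_linForm_ge_of_constraint hκ hRpos.ne' hfixN
  rw [hβ0] at hge hfix
  simp only [ne_eq, OfNat.ofNat_ne_zero, not_false_eq_true, zero_pow, mul_zero, zero_div,
    neg_zero] at hge hfix
  have hQpos : 0 < ∑ i, x i * ∑ j, Real.cos (θ i - θ j) * (x i - x j) := by
    rcases hge.lt_or_eq with h | h
    · exact h
    · exact absurd (eq_zero_of_fixed_of_orderParam hκ (hfix h.symm) hβ0 hK) hx0
  rw [hWQ]
  have : 0 < c * ∑ i, x i * ∑ j, Real.cos (θ i - θ j) * (x i - x j) := mul_pos hc hQpos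
  linarith

/-- **`J𝟙 = 0`: the rotation is a kernel vector, so `0` is an eigenvalue** (from the form alone, by
polarisation and `Q(x + 𝟙) = Q(x)`, `Q(𝟙) = 0`). [cite: BronskiDeVillePark2012, §2.2 («one of the eigenvalues of the Jacobian is zero») (arXiv:1111.5302 p0006 L18–L20)] -/
theorem exists_eigenvalues_eq_zero (hW : W.IsHermitian)
    (hWQ : ∀ x : Fin n → ℝ,
      x ⬝ᵥ W *ᵥ x = -(c * ∑ i, x i * ∑ j, Real.cos (θ i - θ j) * (x i - x j)))
    (hn : 0 < n) : ∃ i, hW.eigenvalues i = 0 := by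
  classical
  set one : Fin n → ℝ := fun _ => 1 with hone_def
  have hQ1 : ∀ y : Fin n → ℝ, (y + one) ⬝ᵥ W *ᵥ (y + one) = y ⬝ᵥ W *ᵥ y := by
    intro y
    rw [hWQ, hWQ]
    have h := allToAll_linForm_add_const θ y 1
    simp only [hone_def, Pi.add_apply]
    rw [h]
  have hQone : one ⬝ᵥ W *ᵥ one = 0 := by
    rw [hWQ]
    simp [hone_def]
  have hT : Wᵀ = W := by
    have h := hW.eq
    rwa [conjTranspose_eq_transpose_of_trivial] at h
  have hsymm : ∀ y : Fin n → ℝ, one ⬝ᵥ W *ᵥ y = y ⬝ᵥ W *ᵥ one := by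
    intro y
    calc one ⬝ᵥ W *ᵥ y = (one ᵥ* W) ⬝ᵥ y := dotProduct_mulVec _ _ _
      _ = (Wᵀ *ᵥ one) ⬝ᵥ y := by rw [mulVec_transpose]
      _ = (W *ᵥ one) ⬝ᵥ y := by rw [hT]
      _ = y ⬝ᵥ W *ᵥ one := dotProduct_comm _ _
  have horth : ∀ y : Fin n → ℝ, y ⬝ᵥ W *ᵥ one = 0 := by
    intro y
    have h := hQ1 y
    rw [mulVec_add, add_dotProduct, dotProduct_add, dotProduct_add, hsymm, hQone] at h
    linarith
  have hW1 : W *ᵥ one = 0 := dotProduct_self_eq_zero.1 (horth (W *ᵥ one))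
  have hone : one ≠ 0 := fun h => by
    have := congrFun h ⟨0, hn⟩
    simp [hone_def] at this
  have hdet : W.det = 0 := Matrix.exists_mulVec_eq_zero_iff.1 ⟨one, hone, hW1⟩
  have hprod := hW.det_eq_prod_eigenvalues
  rw [hdet] at hprod
  simp only [RCLike.ofReal_real_eq_id, id_eq] at hprod
  obtain ⟨i, _, hi⟩ := Finset.prod_eq_zero_iff.1 hprod.symm
  exact ⟨i, hi⟩

/-- ★★★ **BDP THEOREM 2.2 (the index theorem), for a real symmetric matrix `W` whose form is `−c·Q`
(`c > 0`; `W = γJ(θ)`):** if every `κᵢ ≠ 0` («`D` invertible») and `τ ≠ 2`, then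
`n₊(W) = #{i : κᵢ < 0} + [τ > 2]` («`n₊(J) = n₊(−D) + {0, τ < 2; 1, τ > 2}`», with Prop. 2.1
`n₊(−D) = #{κᵢ < 0}`), the eigenvalue `0` is SIMPLE (the rotation), and the remaining
`n − 1 − #{κᵢ < 0} − [τ > 2]` eigenvalues are negative. [cite: BronskiDeVillePark2012, §2.2 Theorem 2.2 with Proposition 2.1 and Definition 2.2 (arXiv:1111.5302 p0005 L86–p0006 L100)] -/
theorem inertia_of_allToAll_linForm (hW : W.IsHermitian) (hc : 0 < c)
    (hWQ : ∀ x : Fin n → ℝ,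
      x ⬝ᵥ W *ᵥ x = -(c * ∑ i, x i * ∑ j, Real.cos (θ i - θ j) * (x i - x j)))
    (hn : 0 < n) (hκ : ∀ i, ∑ j, Real.cos (θ i - θ j) ≠ 0)
    (hτ : ∑ i, 1 / ∑ j, Real.cos (θ i - θ j) ≠ 2) :
    (univ.filter fun i => 0 < hW.eigenvalues i).card
        = (univ.filter fun i => ∑ j, Real.cos (θ i - θ j) < 0).card
          + (if 2 < ∑ i, 1 / ∑ j, Real.cos (θ i - θ j) then 1 else 0)
      ∧ (univ.filter fun i => hW.eigenvalues i = 0).card = 1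
      ∧ (univ.filter fun i => hW.eigenvalues i < 0).card
        = n - 1 - (univ.filter fun i => ∑ j, Real.cos (θ i - θ j) < 0).card
          - (if 2 < ∑ i, 1 / ∑ j, Real.cos (θ i - θ j) then 1 else 0) := by
  classical
  have hnn : (univ.filter fun i => 0 ≤ hW.eigenvalues i).card
      = (univ.filter fun i => 0 < hW.eigenvalues i).card
        + (univ.filter fun i => hW.eigenvalues i = 0).card := by
    rw [← Finset.card_union_of_disjoint]
    · congr 1
      ext i
      simp only [Finset.mem_filter, Finset.mem_univ, true_and, Finset.mem_union]
      constructor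
      · intro h
        rcases h.lt_or_eq with h | h
        · exact Or.inl h
        · exact Or.inr h.symm
      · rintro (h | h)
        · exact h.le
        · rw [h]
    · exact Finset.disjoint_filter.2 fun i _ h1 h2 => by rw [h2] at h1; exact lt_irrefl _ h1
  have htot : (univ.filter fun i => 0 ≤ hW.eigenvalues i).card
      + (univ.filter fun i => hW.eigenvalues i < 0).card = n := by
    have h := Finset.card_filter_add_card_filter_not
      (s := (univ : Finset (Fin n))) (fun i => 0 ≤ hW.eigenvalues i)
    have e : (univ.filter fun i => ¬ 0 ≤ hW.eigenvalues i)
        = (univ.filter fun i => hW.eigenvalues i < 0) := by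
      ext i; simp
    rw [e, Finset.card_univ, Fintype.card_fin] at h
    exact h
  obtain ⟨i0, hi0⟩ := exists_eigenvalues_eq_zero hW hWQ hn
  have hz1 : 1 ≤ (univ.filter fun i => hW.eigenvalues i = 0).card :=
    Finset.card_pos.2 ⟨i0, by simp [hi0]⟩
  have hA := card_rowSum_neg_le_card_eigenvalues_pos hW hc hWQ
  rcases lt_or_gt_of_ne hτ with hlt | hgt
  · have hB := card_eigenvalues_pos_le_card_rowSum_neg hW hc hWQ hκ hlt.le
    have hC := card_eigenvalues_nonneg_le_card_rowSum_neg_succ hW hc hWQ hκ hlt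
    rw [if_neg (not_lt.2 hlt.le)]
    omega
  · have hA' := card_rowSum_neg_succ_le_card_eigenvalues_pos hW hc hWQ hκ hgt
    have hB := card_eigenvalues_pos_le_card_rowSum_neg_succ hW hc hWQ hκ
    have hC := card_eigenvalues_nonneg_le_card_rowSum_neg_add_two hW hc hWQ hκ
    rw [if_pos hgt]
    omega

/-- **Corollary (Definition 1.1 / Remark 2.2): type zero ⇔ the strict criterion.** Under `κᵢ ≠ 0`,
`τ ≠ 2`: `n₊(W) = 0 ⇔ (∀ i, κᵢ > 0) ∧ τ < 2`, and then `0` is simple — «negative semi-definite with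
a one-dimensional kernel», a fully synchronous state. [cite: BronskiDeVillePark2012, §1 Definition 1.1, §2.2 Theorem 2.2 and Remark 2.2 (arXiv:1111.5302 p0003 L140–p0004 L9, p0006, p0007 L50–L54)] -/
theorem card_eigenvalues_pos_eq_zero_iff (hW : W.IsHermitian) (hc : 0 < c)
    (hWQ : ∀ x : Fin n → ℝ,
      x ⬝ᵥ W *ᵥ x = -(c * ∑ i, x i * ∑ j, Real.cos (θ i - θ j) * (x i - x j)))
    (hn : 0 < n) (hκ : ∀ i, ∑ j, Real.cos (θ i - θ j) ≠ 0)
    (hτ : ∑ i, 1 / ∑ j, Real.cos (θ i - θ j) ≠ 2) :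
    (univ.filter fun i => 0 < hW.eigenvalues i).card = 0
      ↔ (∀ i, 0 < ∑ j, Real.cos (θ i - θ j)) ∧ ∑ i, 1 / ∑ j, Real.cos (θ i - θ j) < 2 := by
  obtain ⟨h1, -, -⟩ := inertia_of_allToAll_linForm hW hc hWQ hn hκ hτ
  rw [h1]
  constructor
  · intro h
    have hm : (univ.filter fun i => ∑ j, Real.cos (θ i - θ j) < 0).card = 0 := by omega
    have hs : ¬ 2 < ∑ i, 1 / ∑ j, Real.cos (θ i - θ j) := fun h' => by
      rw [if_pos h'] at h; omega
    refine ⟨fun i => ?_, lt_of_le_of_ne (not_lt.1 hs) hτ⟩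
    rcases lt_or_gt_of_ne (hκ i) with hi | hi
    · have : i ∈ (univ.filter fun i => ∑ j, Real.cos (θ i - θ j) < 0) := by simp [hi]
      rw [Finset.card_eq_zero.1 hm] at this
      simp at this
    · exact hi
  · rintro ⟨hpos, hlt⟩
    rw [if_neg (not_lt.2 hlt.le), add_zero, Finset.card_eq_zero, Finset.filter_eq_empty_iff]
    intro i _
    exact not_lt.2 (hpos i).le

end Index

/-! ### §4. THE MODEL: the stability matrix `−L(θ)` of the uniformly all-to-all coupled network and
the Jacobian of the classic model -/

section Model

variable (k : ℝ) (Kur : NonuniformKuramoto n)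

/-- Uniform complete coupling is symmetric (private helper). [folklore] -/
private theorem complete_weights_symm' (c : Fin n → Fin n → ℝ)
    (hc : ∀ i j, c i j = if i = j then 0 else k) (i j : Fin n) : c i j = c j i := by
  rw [hc, hc]
  by_cases h : i = j
  · subst h; rfl
  · rw [if_neg h, if_neg (Ne.symm h)]

/-- For the uniformly all-to-all coupled network the stability matrix `−L(θ)` (weights
`Pᵢⱼcos(θᵢ − θⱼ)`, `Pᵢⱼ = k` off the diagonal) is symmetric … [cite: BronskiDeVillePark2012, §2.2 eq. (J) (arXiv:1111.5302 p0005 L97–L101)] -/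
theorem complete_isHermitian_neg_lap (hP : ∀ i j, Kur.P i j = if i = j then 0 else k)
    (θ : Fin n → ℝ) : (-Kur.toDroopNetwork.lap θ).IsHermitian :=
  Kur.isHermitian_neg_lap (complete_weights_symm' k Kur.P hP) θ

/-- … and its quadratic form is `−k·Q`: `zᵀ(−L(θ))z = −k Σᵢ zᵢ Σⱼ cos(θᵢ − θⱼ)(zᵢ − zⱼ)` (`−L(θ) = kJ(θ)`).
[cite: BronskiDeVillePark2012, §2.2 eqs. (J), (rank2) (arXiv:1111.5302 p0005 L97–L128)] -/
theorem complete_neg_lap_form (hP : ∀ i j, Kur.P i j = if i = j then 0 else k) (θ x : Fin n → ℝ) :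
    x ⬝ᵥ (-Kur.toDroopNetwork.lap θ) *ᵥ x
      = -(k * ∑ i, x i * ∑ j, Real.cos (θ i - θ j) * (x i - x j)) := by
  rw [Matrix.neg_mulVec, dotProduct_neg, Kur.dotProduct_lap_mulVec]
  simp only [toDroopNetwork_linWeight]
  rw [linForm_complete_eq k Kur.P hP]

/-- ★★★ **BDP THEOREM 2.2 — THE TYPE OF EVERY CONFIGURATION OF THE ALL-TO-ALL KURAMOTO MODEL.**
MODEL: first-order (non-uniform) Kuramoto oscillators, lossless, uniform complete coupling `Pᵢⱼ = k > 0`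
(`i ≠ j`), ANY natural frequencies, `N ≥ 1`. For every configuration `θ` with all row sums
`κᵢ(θ) = Σⱼ cos(θᵢ − θⱼ) ≠ 0` and `τ(θ) = Σᵢ 1/κᵢ(θ) ≠ 2`, the symmetric stability matrix `−L(θ)`
(`= kJ(θ)`) has exactly `#{i : κᵢ < 0} + [τ > 2]` positive eigenvalues, the eigenvalue `0` is simple
(the rotation `𝟙`), and all other eigenvalues are negative. In particular the TYPE of a locked
state (number of unstable directions of `θ̇ = ω − D⁻¹L`-linearisation for `D = 1`) is
`n₊(−D) + [τ > 2]`. [cite: BronskiDeVillePark2012, §2.2 Theorem 2.2, Proposition 2.1, Definition 2.2 (arXiv:1111.5302 p0005 L86–p0006 L100)] -/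
theorem complete_inertia_neg_lap (hk : 0 < k) (hP : ∀ i j, Kur.P i j = if i = j then 0 else k)
    (hn : 0 < n) (θ : Fin n → ℝ) (hκ : ∀ i, ∑ j, Real.cos (θ i - θ j) ≠ 0)
    (hτ : ∑ i, 1 / ∑ j, Real.cos (θ i - θ j) ≠ 2)
    (hH : (-Kur.toDroopNetwork.lap θ).IsHermitian) :
    (univ.filter fun i => 0 < hH.eigenvalues i).card
        = (univ.filter fun i => ∑ j, Real.cos (θ i - θ j) < 0).card
          + (if 2 < ∑ i, 1 / ∑ j, Real.cos (θ i - θ j) then 1 else 0)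
      ∧ (univ.filter fun i => hH.eigenvalues i = 0).card = 1
      ∧ (univ.filter fun i => hH.eigenvalues i < 0).card
        = n - 1 - (univ.filter fun i => ∑ j, Real.cos (θ i - θ j) < 0).card
          - (if 2 < ∑ i, 1 / ∑ j, Real.cos (θ i - θ j) then 1 else 0) :=
  inertia_of_allToAll_linForm hH hk (Kur.complete_neg_lap_form k hP θ) hn hκ hτ

/-- ★★ **Type zero ⇔ strict criterion, in the model** (`κᵢ ≠ 0`, `τ ≠ 2`): `−L(θ)` has no positive
eigenvalue iff `κᵢ > 0` for all `i` and `Σ 1/κᵢ < 2` — the interior `𝒮_θ` of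
`CompleteKuramotoStabilityCriterion.lean`. [cite: BronskiDeVillePark2012, §2.2 Theorem 2.2, Remark 2.2, Lemma 2.4 (k2)–(k3) (arXiv:1111.5302 p0006–p0007)] -/
theorem complete_typeZero_iff (hk : 0 < k) (hP : ∀ i j, Kur.P i j = if i = j then 0 else k)
    (hn : 0 < n) (θ : Fin n → ℝ) (hκ : ∀ i, ∑ j, Real.cos (θ i - θ j) ≠ 0)
    (hτ : ∑ i, 1 / ∑ j, Real.cos (θ i - θ j) ≠ 2)
    (hH : (-Kur.toDroopNetwork.lap θ).IsHermitian) :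
    (univ.filter fun i => 0 < hH.eigenvalues i).card = 0
      ↔ (∀ i, 0 < ∑ j, Real.cos (θ i - θ j)) ∧ ∑ i, 1 / ∑ j, Real.cos (θ i - θ j) < 2 :=
  card_eigenvalues_pos_eq_zero_iff hH hk (Kur.complete_neg_lap_form k hP θ) hn hκ hτ

/-- For the classic model (`Dᵢ = 1`) the Jacobian of the vector field IS `−L(θ)` (`auxJac θ = −L(θ)`,
`hasFDerivAt_field`), hence symmetric. [cite: BronskiDeVillePark2012, §2.2 eq. (J) («`Jᵢⱼ(θ) := ∂fᵢ/∂θⱼ`») (arXiv:1111.5302 p0005 L97–L101)] -/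
theorem classic_isHermitian_auxJac (Kc : ℝ) (ω θ : Fin n → ℝ) :
    ((classic n Kc ω).toDroopNetwork.auxJac θ).IsHermitian := by
  rw [(classic n Kc ω).jacobian_eq_neg_lap (fun _ => rfl) θ]
  exact (classic n Kc ω).complete_isHermitian_neg_lap (Kc / (n : ℝ)) (fun _ _ => rfl) θ

/-- ★★★ **BDP THEOREM 2.2 for the classic finite-`N` Kuramoto model `θ̇ᵢ = ωᵢ − (K/N)Σⱼ sin(θᵢ − θⱼ)`
(`K > 0`, ANY `ω`): the Jacobian `∂f/∂θ(θ)` at ANY configuration with `κᵢ ≠ 0`, `τ ≠ 2` has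
`#{κᵢ < 0} + [τ > 2]` positive eigenvalues, a simple zero, and the rest negative.**
[cite: BronskiDeVillePark2012, §2.2 Theorem 2.2 with Proposition 2.1 (arXiv:1111.5302 p0005 L150–p0006 L100)] -/
theorem classic_inertia_jacobian {Kc : ℝ} (hKc : 0 < Kc) (hn : 0 < n) (ω θ : Fin n → ℝ)
    (hκ : ∀ i, ∑ j, Real.cos (θ i - θ j) ≠ 0) (hτ : ∑ i, 1 / ∑ j, Real.cos (θ i - θ j) ≠ 2)
    (hJ : ((classic n Kc ω).toDroopNetwork.auxJac θ).IsHermitian) :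
    (univ.filter fun i => 0 < hJ.eigenvalues i).card
        = (univ.filter fun i => ∑ j, Real.cos (θ i - θ j) < 0).card
          + (if 2 < ∑ i, 1 / ∑ j, Real.cos (θ i - θ j) then 1 else 0)
      ∧ (univ.filter fun i => hJ.eigenvalues i = 0).card = 1
      ∧ (univ.filter fun i => hJ.eigenvalues i < 0).card
        = n - 1 - (univ.filter fun i => ∑ j, Real.cos (θ i - θ j) < 0).card
          - (if 2 < ∑ i, 1 / ∑ j, Real.cos (θ i - θ j) then 1 else 0) := by
  refine inertia_of_allToAll_linForm hJ (div_pos hKc (Nat.cast_pos.2 hn)) (fun x => ?_) hn hκ hτ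
  rw [(classic n Kc ω).jacobian_eq_neg_lap (fun _ => rfl) θ]
  exact (classic n Kc ω).complete_neg_lap_form (Kc / (n : ℝ)) (fun _ _ => rfl) θ x

/-- ★★ **Classic model: the Jacobian has no unstable direction iff `κᵢ > 0 ∀ i` and `Σ 1/κᵢ < 2`**
(`κᵢ ≠ 0`, `τ ≠ 2`; then `0` is simple: a fully synchronous state, Def. 1.1).
[cite: BronskiDeVillePark2012, §1 Definition 1.1, §2.2 Theorem 2.2, Remark 2.2 (arXiv:1111.5302 p0003–p0007)] -/
theorem classic_typeZero_iff {Kc : ℝ} (hKc : 0 < Kc) (hn : 0 < n) (ω θ : Fin n → ℝ)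
    (hκ : ∀ i, ∑ j, Real.cos (θ i - θ j) ≠ 0) (hτ : ∑ i, 1 / ∑ j, Real.cos (θ i - θ j) ≠ 2)
    (hJ : ((classic n Kc ω).toDroopNetwork.auxJac θ).IsHermitian) :
    (univ.filter fun i => 0 < hJ.eigenvalues i).card = 0
      ↔ (∀ i, 0 < ∑ j, Real.cos (θ i - θ j)) ∧ ∑ i, 1 / ∑ j, Real.cos (θ i - θ j) < 2 := by
  refine card_eigenvalues_pos_eq_zero_iff hJ (div_pos hKc (Nat.cast_pos.2 hn)) (fun x => ?_) hn hκ hτ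
  rw [(classic n Kc ω).jacobian_eq_neg_lap (fun _ => rfl) θ]
  exact (classic n Kc ω).complete_neg_lap_form (Kc / (n : ℝ)) (fun _ _ => rfl) θ x

end Model

end NonuniformKuramoto

end Literature.MathematicalPhysics.PowerSystems

end
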